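import Literature.IUT.LogVolume.PrincipalArithmeticDivisors
import Literature.IUT.LogVolume.HeightDivisor
import Literature.IUT.LogVolume.IdealArithmeticDivisors
import Literature.NumberTheory.DiophantineGeometry.GenEllConductorHeight
import HarnessLib

/-!
# [GenEll] Prop. 1.6 for `(ℙ¹_ℤ, [0]+[1]+[∞])` at the level of arithmetic divisors: the reduced
# conductor is dominated by three pole divisors; change of section for `x_F^*𝒪̄(1)`

S. Mochizuki, *Arithmetic elliptic curves in general position*, Math. J. Okayama Univ. **52** (2010),
Prop. 1.6 (journal p. 10; kurims p. 9), proof: "the asserted inequality `log-cond_D ≲ ht_L̄` follows, for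
the contributions at the nonarchimedean primes, from the definition of `log-cond_D` [i.e., involving
“`(−)_red`”] in Definition 1.5, (iv), and, for the contributions at the archimedean primes, from the fact
that the continuous function `|s|_L̄` on the compact topological space `X_arc` is bounded."

The NUMERIC form of Prop. 1.6 for the `λ`-line — `NFPoint.logCond_le : log-cond(λ) ≤ 3·ht(λ) + log 2`,
`bdLe_logCond_three_mul_ht` — is ALREADY in the tree (`GenEllConductorHeight.lean`) and is NOT restated
here. This file records the two DIVISOR-LEVEL statements the printed proof is phrased in, over the
arithmetic divisors of this directory ([IUTchIV] Def. 1.9 `ADivisor`; `heightDivisor` = `x_F^*(𝒪̄(1), X₁)`,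
`condDivisor` = `(D_x)_red`, `ADivisor.principal` = `ADiv(f)`):

* **`condDivisor_le`**: `(D_λ)_red ≤ x_F^*𝒪̄(1)[λ⁻¹] + x_F^*𝒪̄(1)[λ] + x_F^*𝒪̄(1)[(λ−1)⁻¹]`
  coefficientwise ("from the definition of `log-cond_D` involving `(−)_red`": a prime in the support of the
  conductor is a pole of `λ⁻¹`, `λ` or `(λ−1)⁻¹`, where the pole divisor has coefficient `≥ 1`; the
  archimedean coefficients on the right are `[F_v:ℝ]·log⁺|·|_v ≥ 0` — "the continuous function `|s|` … is
  bounded"), hence `degF_condDivisor_le : deg_F((D_λ)_red) ≤ h(λ⁻¹) + h(λ) + h((λ−1)⁻¹)` and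
  `degF_condDivisor_le_three_mul : deg_F((D_λ)_red) ≤ 3·h_F(λ) + [F:ℚ]·log 2` (Mathlib `logHeight₁_inv`,
  `logHeight₁_sub_le`); dividing by `[F:ℚ]` is exactly the tree's `NFPoint.logCond_le`.
* **Change of section** (`ht_L̄` does not depend on the section used to compute `x_F^*L̄`, by the product
  formula): `heightDivisor x − heightDivisor x⁻¹ = −ADiv(x)` (`X₁` vs `X₀`) and
  `degF_heightDivisor_inv : deg_F(heightDivisor x⁻¹) = deg_F(heightDivisor x)` (`degF_principal`).
Bookkeeping: `degF_mono`, `sum_inr_mul_logNorm_le_degF`, `ADivisor.reduced_apply_inl`.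
Classical; no statement of the disputed corpus is involved. [cite: MochizukiGenEll2010, Prop. 1.6 p.10]
-/

noncomputable section

namespace Literature.IUT.LogVolume

open NumberField IsDedekindDomain Finset Real
open Literature.NumberTheory.DiophantineGeometry.GenEll

variable (F : Type*) [Field F] [NumberField F]

/-! ### Bookkeeping on degrees -/

variable {F} in
/-- `deg_F` is monotone: `𝔞 ≤ 𝔟` coefficientwise implies `deg_F(𝔞) ≤ deg_F(𝔟)` (the weights `log q_v`,
`1` are positive). [cite: MochizukiGenEll2010, Prop. 1.6 p.10] -/
theorem degF_mono {a b : ADivisor F} (h : a ≤ b) : degF F a ≤ degF F b := by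
  have hab : (b - a).IsEffective := fun v => by
    rw [Finsupp.sub_apply, sub_nonneg]
    exact h v
  have := degF_nonneg F hab
  rw [map_sub] at this
  linarith

variable {F} in
/-- For an effective `𝔞` and any finite set `T` of finite places, `Σ_{v ∈ T} c_v·log(q_v) ≤ deg_F(𝔞)`.
[cite: MochizukiGenEll2010, Prop. 1.6 p.10] -/
theorem sum_inr_mul_logNorm_le_degF {a : ADivisor F} (ha : a.IsEffective)
    (T : Finset (HeightOneSpectrum (𝓞 F))) :
    ∑ v ∈ T, a (Sum.inr v) * logNorm F v ≤ degF F a := by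
  classical
  rw [degF_apply, Finsupp.sum]
  have h1 : ∑ v ∈ T, a (Sum.inr v) * logNorm F v =
      ∑ p ∈ T.map ⟨Sum.inr, Sum.inr_injective⟩, a p * degWeight F p := by
    rw [Finset.sum_map]
    rfl
  rw [h1, ← Finset.sum_filter_of_ne (p := fun p => p ∈ a.support)
    (fun p _ hp => Finsupp.mem_support_iff.mpr (left_ne_zero_of_mul hp))]
  refine Finset.sum_le_sum_of_subset_of_nonneg (fun p hp => (Finset.mem_filter.mp hp).2) ?_
  intro p _ _
  exact mul_nonneg (ha p) (degWeight_pos F p).le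

variable {F} in
omit [NumberField F] in
/-- A reduced divisor has no archimedean part. [cite: MochizukiGenEll2010, Def. 1.5 (iv) p.9] -/
theorem ADivisor.reduced_apply_inl (S : Finset (HeightOneSpectrum (𝓞 F))) (w : InfinitePlace F) :
    ADivisor.reduced S (Sum.inl w) = 0 := by
  classical
  rw [ADivisor.reduced, Finsupp.finsetSum_apply]
  exact Finset.sum_eq_zero fun v _ => by simp

variable {F} in
/-- A pole of `y` at `v` (`ord_v(y) < 0`) gives coefficient `≥ 1` in the pole divisor of `y`.
[cite: MochizukiGenEll2010, Prop. 1.6 p.10] -/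
theorem one_le_heightDivisor_apply_inr_of_ord_neg {y : F} {v : HeightOneSpectrum (𝓞 F)}
    (h : ord F v y < 0) : 1 ≤ ADivisor.heightDivisor y (Sum.inr v) := by
  rw [ADivisor.heightDivisor_apply_inr]
  have : 0 < (-ord F v y).toNat := Int.lt_toNat.mpr (by simpa using h)
  exact_mod_cast this

/-! ### Change of section: `X₁` versus `X₀` -/

variable {F} in
/-- **Change of section**: `x_F^*(𝒪̄(1), X₁) − x_F^*(𝒪̄(1), X₀) = −ADiv(x)`, i.e.
`heightDivisor x − heightDivisor x⁻¹ = −ADiv(x)` (`log⁺ t − log⁺ t⁻¹ = log t`, `max(0,−n) − max(0,n) = −n`).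
[cite: MochizukiGenEll2010, §1 p.5] -/
theorem ADivisor.heightDivisor_sub_heightDivisor_inv (x : F) :
    ADivisor.heightDivisor x - ADivisor.heightDivisor x⁻¹ = -ADivisor.principal x := by
  ext (w | v)
  · simp only [Finsupp.sub_apply, ADivisor.heightDivisor_apply_inl, map_inv₀, Finsupp.neg_apply,
      ADivisor.principal_apply_inl, neg_neg, ← mul_sub, posLog_sub_posLog_inv]
  · simp only [Finsupp.sub_apply, ADivisor.heightDivisor_apply_inr, ord_inv, neg_neg, Finsupp.neg_apply,
      ADivisor.principal_apply_inr]
    have h := Int.toNat_sub_toNat_neg (-ord F v x)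
    rw [neg_neg] at h
    have h' : (((-ord F v x).toNat : ℤ) : ℝ) - (((ord F v x).toNat : ℤ) : ℝ) = ((-ord F v x : ℤ) : ℝ) := by
      exact_mod_cast h
    push_cast at h'
    linarith

/-- Independence of the section (product formula): `deg_F(x_F^*(𝒪̄(1), X₀)) = deg_F(x_F^*(𝒪̄(1), X₁))`,
i.e. `deg_F(heightDivisor x⁻¹) = deg_F(heightDivisor x)` — `h(x⁻¹) = h(x)` recovered from
`degF_principal`. [cite: MochizukiGenEll2010, §1 p.5] -/
theorem degF_heightDivisor_inv (x : F) :
    degF F (ADivisor.heightDivisor x⁻¹) = degF F (ADivisor.heightDivisor x) := by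
  have h := congrArg (degF F) (ADivisor.heightDivisor_sub_heightDivisor_inv x)
  rw [map_sub, map_neg, degF_principal, neg_zero, sub_eq_zero] at h
  exact h.symm

/-! ### The reduced conductor is dominated by the three pole divisors -/

/-- **`(D_λ)_red ≤ (poles of λ⁻¹) + (poles of λ) + (poles of (λ−1)⁻¹)`** coefficientwise, for
`λ ∈ U_P(F)`: a prime of the conductor is one where `λ ≡ 0`, `∞` or `1`, i.e. a pole of `λ⁻¹`, `λ`,
resp. `(λ−1)⁻¹`, with pole-divisor coefficient `≥ 1`; the archimedean coefficients of the right-hand side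
are `≥ 0`. [cite: MochizukiGenEll2010, Prop. 1.6 p.10] -/
theorem condDivisor_le (P : NFPoint) (hP : P.InU) :
    condDivisor P hP ≤ ADivisor.heightDivisor P.x⁻¹ + ADivisor.heightDivisor P.x +
      ADivisor.heightDivisor (P.x - 1)⁻¹ := by
  have hx : P.x ≠ 0 := hP.1
  have hx1 : P.x - 1 ≠ 0 := sub_ne_zero.mpr hP.2
  have h0 := ADivisor.heightDivisor_isEffective P.x⁻¹
  have h1 := ADivisor.heightDivisor_isEffective P.x
  have h2 := ADivisor.heightDivisor_isEffective (P.x - 1)⁻¹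
  intro p
  rcases p with w | v
  · rw [condDivisor, ADivisor.reduced_apply_inl, Finsupp.add_apply, Finsupp.add_apply]
    exact add_nonneg (add_nonneg (h0 _) (h1 _)) (h2 _)
  · rw [condDivisor, ADivisor.reduced_apply_inr, Finsupp.add_apply, Finsupp.add_apply]
    have e0 := h0 (Sum.inr v)
    have e1 := h1 (Sum.inr v)
    have e2 := h2 (Sum.inr v)
    split_ifs with hv
    · rw [Set.Finite.mem_toFinset] at hv
      rcases hv with hv | hv | hv
      · have : 1 ≤ ADivisor.heightDivisor P.x⁻¹ (Sum.inr v) :=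
          one_le_heightDivisor_apply_inr_of_ord_neg (by
            rw [ord_inv, neg_lt_zero]; exact (ord_pos_iff_valuation_lt_one _ v hx).mpr hv)
        linarith
      · have : 1 ≤ ADivisor.heightDivisor P.x (Sum.inr v) :=
          one_le_heightDivisor_apply_inr_of_ord_neg ((ord_neg_iff_one_lt_valuation _ v hx).mpr hv)
        linarith
      · have : 1 ≤ ADivisor.heightDivisor (P.x - 1)⁻¹ (Sum.inr v) :=
          one_le_heightDivisor_apply_inr_of_ord_neg (by
            rw [ord_inv, neg_lt_zero]; exact (ord_pos_iff_valuation_lt_one _ v hx1).mpr hv)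
        linarith
    · linarith

/-- Hence **`deg_F((D_λ)_red) ≤ h_F(λ⁻¹) + h_F(λ) + h_F((λ−1)⁻¹)`** (`degF_mono`, `degF_heightDivisor`).
[cite: MochizukiGenEll2010, Prop. 1.6 p.10] -/
theorem degF_condDivisor_le (P : NFPoint) (hP : P.InU) :
    degF P.F (condDivisor P hP) ≤
      Height.logHeight₁ P.x⁻¹ + Height.logHeight₁ P.x + Height.logHeight₁ (P.x - 1)⁻¹ := by
  rw [← degF_heightDivisor, ← degF_heightDivisor, ← degF_heightDivisor, ← map_add, ← map_add]
  exact degF_mono (condDivisor_le P hP)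

/-- **`deg_F((D_λ)_red) ≤ 3·h_F(λ) + [F:ℚ]·log 2`** (`h(λ⁻¹) = h(λ)`, `h((λ−1)⁻¹) = h(λ−1) ≤ h(λ) +
[F:ℚ]·log 2`); dividing by `[F:ℚ]` gives the tree's `NFPoint.logCond_le` (`GenEllConductorHeight.lean`).
[cite: MochizukiGenEll2010, Prop. 1.6 p.10] -/
theorem degF_condDivisor_le_three_mul (P : NFPoint) (hP : P.InU) :
    degF P.F (condDivisor P hP) ≤ 3 * Height.logHeight₁ P.x + P.degree * Real.log 2 := by
  have h := degF_condDivisor_le P hP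
  rw [Height.logHeight₁_inv, Height.logHeight₁_inv] at h
  have hsub : Height.logHeight₁ (P.x - 1) ≤ P.degree * Real.log 2 + Height.logHeight₁ P.x := by
    have h' := Height.logHeight₁_sub_le P.x (1 : P.F)
    rw [Height.logHeight₁_one, add_zero, NumberField.totalWeight_eq_finrank] at h'
    exact h'
  linarith

/-- Consistency with the tree's numeric Prop. 1.6: `[F:ℚ]·log-cond(λ) = deg_F((D_λ)_red)`, so
`degF_condDivisor_le_three_mul` divided by `[F:ℚ]` is `NFPoint.logCond_le` (stated there; here only the
identification of the two left-hand sides). [cite: MochizukiGenEll2010, Prop. 1.6 p.10] -/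
theorem degree_mul_logCond_eq_degF_condDivisor (P : NFPoint) (hP : P.InU) :
    (P.degree : ℝ) * P.logCond = degF P.F (condDivisor P hP) := by
  have hd : (P.degree : ℝ) ≠ 0 := by exact_mod_cast P.degree_pos.ne'
  rw [logCond_eq_ndeg_condDivisor P hP, ndeg_apply]
  change (P.degree : ℝ) * (degF P.F (condDivisor P hP) / (P.degree : ℝ)) = _
  rw [mul_div_cancel₀ _ hd]

end Literature.IUT.LogVolume

end
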